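import Mathlib
import Summits.KontsevichZagierPeriods.Zeta5Search.Families.DualCellRVChart
import Summits.KontsevichZagierPeriods.Zeta5Search.Families.DualCellBZChartProduct
import HarnessLib

/-!
# ζ(5) search — Families: the Beukers–Rhin–Viola integrand (23) on the dual cell of the 6-plan IS `(−1)^{Σp}Λ_{p;q}·[04]/∏g`; inverse chart (P2 g7)

HONEST FRAMING: systematic search; no irrationality claim unless certified.  Cell `pub-zeta5`, prover P2 (g7, 2026-08-22).
Pure algebra over an arbitrary field; nothing about the arithmetic of `ζ(5)`/`ζ(3)`; no number of record moves.

The 6-point analogue of `Families/DualCellBZChartProduct` + `…Inverse` for the chart `RVChart.yOf` of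
`Families/DualCellRVChart`: (1) `RVChart.integrand_pullback` — for every `(p₀,p₁,p₂,p₃;q₁,q₂,q₃) ∈ ℤ⁷` and injective `w`,
`∏_{l<7} letter_l^{wt_l} · J = (−1)^{p₀+p₁+p₂+p₃} · ∏_{j<k}[jk]^{dualExp j k}` with `J = −[03][04]/([01][12][23][34]²)` the
Jacobian chord monomial (a datum) — the integrand of (23) transported to the dual cell is `(−1)^{Σp}Λ_{p;q}·[04]·dw/(g₀g₁g₂g₃)`
as ONE rational-function identity; (2) `RVChart.uOfY_yOf` — the inverse chart: the gap ratios `[12]/[01], [23]/[01], [34]/[01]`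
are `−y₁/(y₁y₃−y₃+1)`, `(y₃−1)/(y₃(y₁y₃−y₃+1))`, `−(y₃−1)/(y₃(y₁y₂y₃−y₃+1))` of `y = RVChart.yOf w`.  These are steps (S2')/(S4')
of the paper theorem `S₃(p;q) = CT_g[Λ_{p;q}]` (`HOME/pub-zeta5-p2/g7/DEXACT-PROOF.md` §8), whose residue/homology part is NOT a
kernel statement.  Standard axioms only.
-/

namespace Summit.KontsevichZagierPeriods.Zeta5Search.Families.Cellular
namespace RVChart

open Finset BZChart

variable {K : Type*} [Field K]

/-- The product over the 10 chords of five points, written out. -/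
theorem prod_pairs5 (f : Fin 5 × Fin 5 → K) : ∏ p ∈ pairsN 5, f p =
    f (0,1) * f (0,2) * f (0,3) * f (0,4) * f (1,2) * f (1,3) * f (1,4) * f (2,3) * f (2,4) * f (3,4) := by
  rw [pairsN, Finset.prod_filter, ← Finset.univ_product_univ, Finset.prod_product]
  simp (config := { decide := true }) only [Fin.prod_univ_five, ite_true, ite_false, mul_one, one_mul, Fin.isValue]
  ring

section letters

variable {w : Fin 5 → K}

/-- The seven letters of (23): `y₁,y₂,y₃, 1−y₁,1−y₂,1−y₃, D₁ = 1−y₃(1−y₁y₂)`. -/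
def letterVal (w : Fin 5 → K) : Fin 7 → K :=
  ![yOf w 0, yOf w 1, yOf w 2, 1 - yOf w 0, 1 - yOf w 1, 1 - yOf w 2, 1 - yOf w 2 * (1 - yOf w 0 * yOf w 1)]

/-- Integer sign exponent of letter `l`. -/
def sgnExp (l : Fin 8) : ℤ := if letterNeg l then 1 else 0

/-- Each letter is the signed chord monomial of the DATA `RVChart.letterNeg/letterExp`. -/
theorem letterVal_eq_cmon (hw : Function.Injective w) (l : Fin 7) :
    letterVal w l = cmon w (sgnExp (Fin.castSucc l)) (letterExp (Fin.castSucc l)) := by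
  have hsne : ∀ {i j : Fin 5}, i ≠ j → w i - w j ≠ 0 := fun h => sub_ne_zero.mpr (hw.ne h)
  fin_cases l <;>
    simp [letterVal, cmon, sgnExp, prod_pairs5, letterNeg, letterExp, yOf_eq hw, zpow_neg, zpow_ofNat] <;>
    field_simp (disch := first | assumption | exact hsne (by decide)) <;> ring

/-- The Jacobian `∂(y₁,y₂,y₃)/∂(w₁,w₂,w₃)` AS A CHORD MONOMIAL (row 7 of `letterExp`): `−[03][04]/([01][12][23][34]²)` (a datum). -/
def jacMon (w : Fin 5 → K) : K := cmon w 1 (letterExp 7)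

/-- **The assembled pull-back identity for (23).** -/
theorem integrand_pullback (hw : Function.Injective w) (p₀ p₁ p₂ p₃ q₁ q₂ q₃ : ℤ) :
    (∏ l : Fin 7, letterVal w l ^ letterWt p₀ p₁ p₂ p₃ q₁ q₂ q₃ (Fin.castSucc l)) * jacMon w =
      cmon w (p₀ + p₁ + p₂ + p₃) (dualExp p₀ p₁ p₂ p₃ q₁ q₂ q₃) := by
  have hL : ∀ l : Fin 7, letterVal w l ^ letterWt p₀ p₁ p₂ p₃ q₁ q₂ q₃ (Fin.castSucc l) =
      cmon w (sgnExp (Fin.castSucc l)) (letterExp (Fin.castSucc l)) ^ letterWt p₀ p₁ p₂ p₃ q₁ q₂ q₃ (Fin.castSucc l) := by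
    intro l; rw [letterVal_eq_cmon hw l]
  rw [Finset.prod_congr rfl fun l _ => hL l, prod_cmon_zpow hw, jacMon,
    show cmon w 1 (letterExp 7) = cmon w 1 (letterExp 7) ^ (1 : ℤ) by rw [zpow_one], cmon_zpow, cmon_mul hw]
  have hE : (fun j k => (∑ l : Fin 7, letterExp (Fin.castSucc l) j k * letterWt p₀ p₁ p₂ p₃ q₁ q₂ q₃ (Fin.castSucc l)) +
      letterExp 7 j k * 1) = dualExp p₀ p₁ p₂ p₃ q₁ q₂ q₃ := by
    funext j k
    have h := chordExp_total p₀ p₁ p₂ p₃ q₁ q₂ q₃ j k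
    rw [Fin.sum_univ_castSucc] at h
    simp only [Fin.last] at h
    rw [← h]
    simp only [mul_comm (letterWt _ _ _ _ _ _ _ _) _, mul_one]
    simp [letterWt]
  have hS : (∑ l : Fin 7, sgnExp (Fin.castSucc l) * letterWt p₀ p₁ p₂ p₃ q₁ q₂ q₃ (Fin.castSucc l)) + 1 * 1 =
      (p₀ + p₁ + p₂ + p₃) - 2 * p₀ := by
    simp [Fin.sum_univ_succ, sgnExp, letterNeg, letterWt]
    ring
  rw [hE, hS]
  unfold cmon
  congr 1
  have h1 : (-1 : K) ≠ 0 := neg_ne_zero.mpr one_ne_zero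
  rw [show (p₀ + p₁ + p₂ + p₃) - 2 * p₀ = (p₀ + p₁ + p₂ + p₃) + 2 * (-p₀) by ring, zpow_add₀ h1, zpow_mul]
  norm_num

end letters

/-! ### The inverse chart -/

/-- The three gap ratios `[12]/[01], [23]/[01], [34]/[01]` as rational functions of `y`. -/
def uOfY (y : Fin 3 → K) : Fin 3 → K :=
  ![-y 0 / (y 0 * y 2 - y 2 + 1),
    (y 2 - 1) / (y 2 * (y 0 * y 2 - y 2 + 1)),
    -(y 2 - 1) / (y 2 * (y 0 * y 1 * y 2 - y 2 + 1))]

section inverse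

variable {w : Fin 5 → K}

/-- Distinct points have non-zero differences. -/
private theorem sne5 (hw : Function.Injective w) {i j : Fin 5} (h : i ≠ j) : w i - w j ≠ 0 :=
  sub_ne_zero.mpr (hw.ne h)

/-- `y₁y₃ − y₃ + 1 = [03]/[23]` on the chart (a Plücker relation). -/
theorem aux1_yOf (hw : Function.Injective w) :
    yOf w 0 * yOf w 2 - yOf w 2 + 1 = (w 3 - w 0) / (w 3 - w 2) := by
  rw [yOf_eq hw]; simp
  field_simp (disch := first | assumption | exact sne5 hw (by decide)); ring

/-- `D₁ = y₁y₂y₃ − y₃ + 1 = −[03]/[34]` (polynomial spelling of `RVChart.D1_eq`). -/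
theorem aux2_yOf (hw : Function.Injective w) :
    yOf w 0 * yOf w 1 * yOf w 2 - yOf w 2 + 1 = -(w 3 - w 0) / (w 4 - w 3) := by
  rw [yOf_eq hw]; simp
  field_simp (disch := first | assumption | exact sne5 hw (by decide)); ring

/-- **The inverse chart is correct**: `uOfY (yOf w) = ([12]/[01], [23]/[01], [34]/[01])`. -/
theorem uOfY_yOf (hw : Function.Injective w) : uOfY (yOf w) =
    ![(w 2 - w 1) / (w 1 - w 0), (w 3 - w 2) / (w 1 - w 0), (w 4 - w 3) / (w 1 - w 0)] := by
  unfold uOfY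
  rw [aux1_yOf hw, aux2_yOf hw, yOf_eq hw]
  ext i; fin_cases i <;> simp <;> field_simp (disch := first | assumption | exact sne5 hw (by decide)) <;> ring

end inverse

end RVChart
end Summit.KontsevichZagierPeriods.Zeta5Search.Families.Cellular
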